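import Mathlib
import Summits.ValiantsHypothesis.ValiantsHypothesis.Theses.SymmetroidDescartes
import Summits.ValiantsHypothesis.ValiantsHypothesis.Theorems.SymmetroidDescartesThetaPencilWitnessPencil
import Summits.ValiantsHypothesis.ValiantsHypothesis.Theorems.SymmetroidDescartesThetaPencilWitnessTheta
import Literature.Computability.AlgebraicComplexity.VPDeterminantalQPProofs

/-!
# Route SymmetroidDescartes — support `ThetaPencilWitness` (stmt-ValiantsHypothesis-18502): proof

`Summit.ValiantsHypothesis.ValiantsHypothesis.Theses.SymmetroidDescartes.ThetaPencilWitness`: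
if `PER` is p-computable over `ℂ` then for every `b` there is `c` such that for every `K₀` some
`K ≥ K₀` admits a `K`-term real symmetric lacunary pencil `∑_l t^{d_l} S_l` of size
`m ≤ 2^{c (log₂ K + 1)²}` whose determinant changes sign between `K^{bK} + 2` consecutive positive
points `τ_0 < τ_1 < ⋯`.

## The construction (THETA MONSTER IN THE CLASS)

With `K = N + 1`, `L = log₂ K`, `ν = bK(L+1) + 2`, `β = 2b(L+2) + 8` (so `βN ≥ D = 2ν + 3` once
`N ≥ b + 2`, `digits_cover`):

1. Tavenas' Cor. 3.37 (tree theorem `Tavenas2014_cor_3_37_holds`): `V_ν = h_ν(X^{2^j}; 2^{2^i})`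
   with `h_ν` multilinear, a projection of `PER_{q(ν)}` over `ℚ`; over `ℝ`, `h_ν` is a projection
   of `PER_{q(ν)} ∈ ℝ[x]` (`isProjection_map`), so `L_ℝ(h_ν) ≤ L_ℝ(PER_{q ν}) ≤ (ν+2)^{e₁}` by
   realification of the hypothesis (`isPComputable_perPoly_real_of_complex`, Hrubeš–Yehudayoff).
2. Digit grouping (`exists_theta`): `Θ_ν ∈ ℝ[y_0..y_{N-1}]` with `Θ_ν(t^{2^{βi}}) = V_ν(-t)`,
   `L(Θ_ν) ≤ (ν+2)^{e₁} + 2D·2^β ≤ 2^E`, `deg Θ_ν ≤ 2^β · 2D < 2^E`, `E = (L+1)·A`,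
   `A = (b+3)e₁ + 5b + 14` (`regime_bounds`).
3. `VP ⊆ VQP_det` for one polynomial (`determinantalComplexity_le_two_pow`, BCS Thm. (21.36)):
   `dc(Θ_ν) ≤ 2^{17E²}`; symmetrise (`hasSymmAffineDetRepr_of_hasDetRepr`, GKKP 2011 Thm. 5):
   `Θ_ν = det B`, `B` symmetric affine of size `m = 4·2^{51E²} + 7 ≤ 2^{(51A²+3)(L+1)²}`
   (`size_le_regime`).
4. Restrict to the curve `y_i = t^{2^{βi}}` (`exists_symm_pencil_eval`): a `K = N+1`-term
   symmetric pencil with `det = V_ν(-t)`, which alternates at `t_u = 4^{2u+1}/4^{2^ν}`,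
   `u < K^{bK} + 2 ≤ 2^ν` (`tavenasV_alternates`, `pow_fits`).

References: [Tavenas2014] Cor. 3.37, Lemme 3.36; [GrenetEtAl2011] Thm. 5;
[HrubesYehudayoff2011] Thm 4.2; [BurgisserClausenShokrollahi1997] Thm. (21.36); [Burgisser2000]
Rem. 2.7.
-/

noncomputable section

-- single-conjunct layout: Sub = Summit, duplicated namespace component intended
set_option linter.dupNamespace false

namespace Summit.ValiantsHypothesis.ValiantsHypothesis.Theorems.SymmetroidDescartes

open MvPolynomial Literature.Computability.AlgebraicComplexity

/-! ### Arithmetic of the parameters -/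

/-- The digit variables cover all bit variables: `D = 2ν + 3 ≤ β N` for `ν = b(N+1)(L+1) + 2`,
`β = 2b(L+2) + 8`, whenever `L ≤ N` and `N ≥ b + 2`. [folklore] -/
theorem digits_cover {b N L : ℕ} (hL : L ≤ N) (hN : b + 2 ≤ N) :
    2 * (b * (N + 1) * (L + 1) + 2) + 3 ≤ (2 * b * (L + 2) + 8) * N := by
  have h1 : 2 * b * (L + 1) ≤ 2 * b * (N + 1) := Nat.mul_le_mul_left _ (by omega)
  nlinarith [h1, hN]

/-- The alternation count fits below `2^ν`: `K^{bK} + 2 ≤ 2^{bK(L+1) + 2}` when `K < 2^{L+1}`.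
[folklore] -/
theorem pow_fits {b N L : ℕ} (hK : N + 1 < 2 ^ (L + 1)) :
    (N + 1) ^ (b * (N + 1)) + 2 ≤ 2 ^ (b * (N + 1) * (L + 1) + 2) := by
  have h1 : (N + 1) ^ (b * (N + 1)) ≤ (2 ^ (L + 1)) ^ (b * (N + 1)) :=
    Nat.pow_le_pow_left hK.le _
  rw [← pow_mul, show (L + 1) * (b * (N + 1)) = b * (N + 1) * (L + 1) by ring] at h1
  have h3 : 1 ≤ 2 ^ (b * (N + 1) * (L + 1)) := Nat.one_le_two_pow
  rw [pow_add]
  linarith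

/-- **Regime bookkeeping.** With `P = 2^{L+1} > N + 1`, `ν = b(N+1)(L+1) + 2`,
`β = 2b(L+2) + 8`, `A = (b+3)e₁ + 5b + 14`: the complexity bound `(ν+2)^{e₁} + 2(2ν+3)·2^β`
is at most `2^{(L+1)A} = P^A` and the degree bound `2^β · 2(2ν+3)` is below it
(`ν + 2 ≤ P^{b+3}`, `2(2ν+3) ≤ P^{b+5}`, `2^β ≤ P^{4b+8}`). [folklore] -/
theorem regime_bounds {b e₁ N L : ℕ} (hKP : N + 1 < 2 ^ (L + 1)) :
    (b * (N + 1) * (L + 1) + 2 + 2) ^ e₁ +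
          2 * (2 * (b * (N + 1) * (L + 1) + 2) + 3) * 2 ^ (2 * b * (L + 2) + 8) ≤
        2 ^ ((L + 1) * ((b + 3) * e₁ + 5 * b + 14)) ∧
      2 ^ (2 * b * (L + 2) + 8) * (2 * (2 * (b * (N + 1) * (L + 1) + 2) + 3)) <
        2 ^ ((L + 1) * ((b + 3) * e₁ + 5 * b + 14)) := by
  set P := 2 ^ (L + 1) with hP
  set ν := b * (N + 1) * (L + 1) + 2 with hν
  set β := 2 * b * (L + 2) + 8 with hβ
  have hLP : L + 1 < P := Nat.lt_two_pow_self
  have h2P : 2 ≤ P := by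
    calc 2 = 2 ^ 1 := by norm_num
      _ ≤ 2 ^ (L + 1) := Nat.pow_le_pow_right (by norm_num) (by omega)
  have h1P : 1 ≤ P := by omega
  rw [pow_mul]
  -- (a) `ν + 2 ≤ P^(b+3)`
  have hb : b ≤ P ^ b := (Nat.lt_two_pow_self).le.trans (Nat.pow_le_pow_left h2P b)
  have hνP : ν + 2 ≤ P ^ (b + 3) := by
    have h1 : b * (N + 1) * (L + 1) ≤ P ^ b * P * P :=
      Nat.mul_le_mul (Nat.mul_le_mul hb hKP.le) hLP.le
    have h2 : 4 ≤ P ^ b * P * P := by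
      calc 4 = 1 * 2 * 2 := by norm_num
        _ ≤ P ^ b * P * P := Nat.mul_le_mul (Nat.mul_le_mul (Nat.one_le_pow _ _ h1P) h2P) h2P
    calc ν + 2 = b * (N + 1) * (L + 1) + 4 := by rw [hν]
      _ ≤ 2 * (P ^ b * P * P) := by omega
      _ ≤ P * (P ^ b * P * P) := Nat.mul_le_mul_right _ h2P
      _ = P ^ (b + 3) := by ring
  -- (b) `2(2ν+3) ≤ P^(b+5)`
  have hDP : 2 * (2 * ν + 3) ≤ P ^ (b + 5) := by
    have h4 : 4 ≤ P ^ 2 := by nlinarith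
    calc 2 * (2 * ν + 3) ≤ 4 * (ν + 2) := by omega
      _ ≤ P ^ 2 * P ^ (b + 3) := Nat.mul_le_mul h4 hνP
      _ = P ^ (b + 5) := by rw [← pow_add]; ring_nf
  -- (c) `2^β ≤ P^(4b+8)`
  have hβP : 2 ^ β ≤ P ^ (4 * b + 8) := by
    have h1 : 2 ^ (L + 2) ≤ P * P := by
      rw [pow_succ]
      exact Nat.mul_le_mul_left _ h2P
    have h8 : 2 ^ 8 ≤ P ^ 8 := Nat.pow_le_pow_left h2P 8
    calc 2 ^ β = (2 ^ (L + 2)) ^ (2 * b) * 2 ^ 8 := by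
          rw [hβ, pow_add, ← pow_mul, mul_comm (L + 2)]
      _ ≤ (P * P) ^ (2 * b) * P ^ 8 := Nat.mul_le_mul (Nat.pow_le_pow_left h1 _) h8
      _ = P ^ (4 * b + 8) := by rw [← pow_two, ← pow_mul, ← pow_add]; ring_nf
  -- (d) assembling
  have hA1 : P ^ ((b + 3) * e₁) ≤ P ^ ((b + 3) * e₁ + 5 * b + 13) :=
    Nat.pow_le_pow_right h1P (by omega)
  have hA2 : P ^ (4 * b + 8) * P ^ (b + 5) ≤ P ^ ((b + 3) * e₁ + 5 * b + 13) := by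
    rw [← pow_add]
    exact Nat.pow_le_pow_right h1P (by omega)
  have hA3 : 2 * P ^ ((b + 3) * e₁ + 5 * b + 13) ≤ P ^ ((b + 3) * e₁ + 5 * b + 14) := by
    rw [pow_succ, mul_comm]
    exact Nat.mul_le_mul_left _ h2P
  have hcplx : (ν + 2) ^ e₁ ≤ P ^ ((b + 3) * e₁) := by
    rw [pow_mul]
    exact Nat.pow_le_pow_left hνP e₁
  constructor
  · calc (ν + 2) ^ e₁ + 2 * (2 * ν + 3) * 2 ^ β
        ≤ P ^ ((b + 3) * e₁) + P ^ (b + 5) * P ^ (4 * b + 8) :=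
          Nat.add_le_add hcplx (Nat.mul_le_mul hDP hβP)
      _ ≤ P ^ ((b + 3) * e₁ + 5 * b + 13) + P ^ ((b + 3) * e₁ + 5 * b + 13) := by
          rw [mul_comm (P ^ (b + 5))]
          exact Nat.add_le_add hA1 hA2
      _ ≤ P ^ ((b + 3) * e₁ + 5 * b + 14) := by rw [← two_mul]; exact hA3
  · calc 2 ^ β * (2 * (2 * ν + 3)) ≤ P ^ (4 * b + 8) * P ^ (b + 5) := Nat.mul_le_mul hβP hDP
      _ = P ^ (5 * b + 13) := by rw [← pow_add]; ring_nf
      _ < P ^ ((b + 3) * e₁ + 5 * b + 14) := Nat.pow_lt_pow_right (by omega) (by omega)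

/-- **The size fits the regime**: `4 · (2^{17E²})³ + 7 ≤ 2^{(51A²+3)(L+1)²}` for `E = (L+1)A`,
`A ≥ 1`. [folklore] -/
theorem size_le_regime (A L : ℕ) (hA : 1 ≤ A) :
    4 * (2 ^ (17 * ((L + 1) * A) ^ 2)) ^ 3 + 7 ≤ 2 ^ ((51 * A ^ 2 + 3) * (L + 1) ^ 2) := by
  have h1 : (2 ^ (17 * ((L + 1) * A) ^ 2)) ^ 3 = 2 ^ (51 * ((L + 1) * A) ^ 2) := by
    rw [← pow_mul]; ring_nf
  have hx : 1 ≤ 51 * ((L + 1) * A) ^ 2 := by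
    have : 1 ≤ (L + 1) * A := Nat.one_le_iff_ne_zero.2 (Nat.mul_ne_zero (by omega) (by omega))
    nlinarith
  have h2 : 2 ≤ 2 ^ (51 * ((L + 1) * A) ^ 2) := by
    calc 2 = 2 ^ 1 := by norm_num
      _ ≤ _ := Nat.pow_le_pow_right (by norm_num) hx
  have h3 : 4 * 2 ^ (51 * ((L + 1) * A) ^ 2) + 7 ≤ 2 ^ (51 * ((L + 1) * A) ^ 2 + 3) := by
    rw [pow_add]
    linarith
  have h4 : 51 * ((L + 1) * A) ^ 2 + 3 ≤ (51 * A ^ 2 + 3) * (L + 1) ^ 2 := by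
    have : 1 ≤ (L + 1) ^ 2 := Nat.one_le_pow _ _ (by omega)
    nlinarith
  rw [h1]
  exact h3.trans (Nat.pow_le_pow_right (by norm_num) h4)

/-! ### The witness -/

/-- **Item `ThetaPencilWitness` (stmt-ValiantsHypothesis-18502) holds** — THETA MONSTER IN THE
CLASS: if `PER` is p-computable over `ℂ` then for every `b` there is `c` such that for every
`K₀` some `K ≥ K₀` admits a `K`-term real symmetric lacunary pencil of size
`m ≤ 2^{c(log₂ K + 1)²}` whose determinant has `K^{bK} + 1` strict sign alternations along a
positive increasing sequence. Proof: Tavenas' Cor. 3.37 family `h_ν` (projection of `PER_{q ν}`,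
`h_ν(X^{2^j}; 2^{2^i}) = V_ν`), realification of `PER ∈ VP_ℂ`, digit grouping into
`N = K - 1` variables of width `β = 2b(log₂ K + 2) + 8` with `ν = bK(log₂ K + 1) + 2`,
`VP ⊆ VQP_det` for the single polynomial `Θ_ν` (BCS (21.36)), GKKP symmetrisation, restriction
to the monomial curve `y_i = t^{2^{βi}}` (`det = V_ν(-t)`), and the `2^ν ≥ K^{bK} + 2` sign
alternations of `V_ν` at `-4^{2u+1}/4^{2^ν}` (Lemme 3.36).
[cite: Tavenas2014, Cor. 3.37 and Lemme 3.36; GrenetEtAl2011, Thm 5; HrubesYehudayoff2011, Thm 4.2;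
BurgisserClausenShokrollahi1997, Thm. (21.36)] -/
theorem ThetaPencilWitness_proof :
    Summit.ValiantsHypothesis.ValiantsHypothesis.Theses.SymmetroidDescartes.ThetaPencilWitness := by
  unfold Summit.ValiantsHypothesis.ValiantsHypothesis.Theses.SymmetroidDescartes.ThetaPencilWitness
  intro hper b
  -- Tavenas' family and the real complexity of the permanent
  obtain ⟨q, hq, Hh⟩ := Tavenas2014_cor_3_37_holds
  have hR : IsPComputable (fun n => perPoly (Fin n) ℝ) := isPComputable_perPoly_real_of_complex hper
  obtain ⟨e₁, he₁⟩ :=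
    (IsPBounded.comp_holds (s := fun n => complexity (perPoly (Fin n) ℝ)) hR hq).exists_le_pow
  set A : ℕ := (b + 3) * e₁ + 5 * b + 14 with hA
  refine ⟨51 * A ^ 2 + 3, fun K₀ => ?_⟩
  -- the parameters
  set N : ℕ := max K₀ (b + 2) with hN
  have hNK₀ : K₀ ≤ N := le_max_left _ _
  have hNb : b + 2 ≤ N := le_max_right _ _
  have hN0 : 0 < N := by omega
  set L : ℕ := Nat.log 2 (N + 1) with hL
  have hKP : N + 1 < 2 ^ (L + 1) := Nat.lt_pow_succ_log_self Nat.one_lt_two (N + 1)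
  have hLN : L ≤ N := by
    have h1 : 2 ^ L ≤ N + 1 := Nat.pow_log_le_self 2 (Nat.succ_ne_zero N)
    have h2 : L < 2 ^ L := Nat.lt_two_pow_self
    omega
  set ν : ℕ := b * (N + 1) * (L + 1) + 2 with hν
  set β : ℕ := 2 * b * (L + 2) + 8 with hβ
  have hβ0 : 0 < β := by omega
  have hD : 2 * ν + 3 ≤ β * N := digits_cover hLN hNb
  obtain ⟨hreg, hdeglt⟩ := regime_bounds (b := b) (e₁ := e₁) hKP
  -- Tavenas' `h_ν`, over `ℝ`
  obtain ⟨h, hproj, hml, hsub⟩ := Hh ν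
  have hHc : complexity (MvPolynomial.map (algebraMap ℚ ℝ) h) ≤ (ν + 2) ^ e₁ := by
    have hp : IsProjection (MvPolynomial.map (algebraMap ℚ ℝ) h) (perPoly (Fin (q ν)) ℝ) := by
      have := isProjection_map (algebraMap ℚ ℝ) hproj
      rwa [map_perPoly] at this
    exact (IsProjection.complexity_le_holds hp).trans (he₁ ν)
  have hHdeg : (MvPolynomial.map (algebraMap ℚ ℝ) h).totalDegree ≤ 2 * (2 * ν + 3) := by
    calc (MvPolynomial.map (algebraMap ℚ ℝ) h).totalDegree ≤ h.totalDegree :=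
          Finset.sup_mono (support_map_subset _ _)
      _ ≤ Fintype.card (Fin (2 * ν + 3) ⊕ Fin (2 * ν + 3)) := totalDegree_le_card_of_multilinear hml
      _ = 2 * (2 * ν + 3) := by rw [Fintype.card_sum, Fintype.card_fin]; ring
  -- the theta polynomial
  obtain ⟨Θ, hΘc, hΘdeg, hΘeval⟩ := exists_theta hβ0 hN0 hD (MvPolynomial.map (algebraMap ℚ ℝ) h)
  -- its determinantal complexity
  have hE1 : 1 ≤ (L + 1) * A :=
    Nat.one_le_iff_ne_zero.2 (Nat.mul_ne_zero (by omega) (by omega))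
  have hclt : complexity Θ ≤ 2 ^ ((L + 1) * A) :=
    hΘc.trans ((Nat.add_le_add_right hHc _).trans hreg)
  have hdlt : Θ.totalDegree < 2 ^ ((L + 1) * A) :=
    lt_of_le_of_lt (hΘdeg.trans (Nat.mul_le_mul_left _ hHdeg)) hdeglt
  have hdc : determinantalComplexity Θ ≤ 2 ^ (17 * ((L + 1) * A) ^ 2) :=
    determinantalComplexity_le_two_pow le_rfl hdlt hclt hE1
  obtain ⟨Amat, hAmat⟩ := (hasDetRepr_iff_determinantalComplexity_le_holds Θ _).2 hdc
  -- symmetrise and restrict to the monomial curve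
  obtain ⟨B, hBsymm, hBdeg, hBdet⟩ :=
    hasSymmAffineDetRepr_of_hasDetRepr (k := ℝ) two_ne_zero ⟨Amat, hAmat⟩
  obtain ⟨S, d, hS, hSeval⟩ := exists_symm_pencil_eval B hBdeg hBsymm (fun i => 2 ^ (β * (i : ℕ)))
  obtain ⟨hτpos, hτmono, halt⟩ := tavenasV_alternates ν
  have hfit : (N + 1) ^ (b * (N + 1)) + 2 ≤ 2 ^ ν := pow_fits hKP
  refine ⟨N + 1, by omega, 4 * (2 ^ (17 * ((L + 1) * A) ^ 2)) ^ 3 + 7,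
    size_le_regime A L (by omega), S, d, hS, fun j => -xPt (2 ^ ν) (j : ℕ),
    fun i j hij => hτmono hij, fun j => hτpos j, fun j => ?_⟩
  -- the sign alternation at the `j`-th pair of points
  have hj : (j : ℕ) + 1 < 2 ^ ν := by have := j.2; omega
  have key := halt j hj
  simp only [Fin.val_castSucc, Fin.val_succ]
  rw [hSeval, hSeval, hBdet, hΘeval, hΘeval, eval_map_tavenas_h hsub, eval_map_tavenas_h hsub]
  exact key

end Summit.ValiantsHypothesis.ValiantsHypothesis.Theorems.SymmetroidDescartes

end
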